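import Summits.RiemannHypothesis.RiemannHypothesis.Theorems.GroundBartaPolarPerronFrobeniusFormDomainBottom
import Literature.NumberTheory.LFunctions.WeilGroundStateRealZerosProofs
import HarnessLib

/-!
# RiemannHypothesis / GroundBarta — rung 4 (`EvenWinsBeyondArch`, stmt-RiemannHypothesis-18807):
# the deflated Temple (Lehmann–Maehly) L-side programme, II — transfer of a low-precision certificate
# from smooth sector tests to the sector form domain

Helper file (`--supports stmt-RiemannHypothesis-18807`), RH-free, Mathlib + landed tree files only, no
definitions, no named facts.

The `β`-input of the deflated Temple bound (`Literature.Analysis.OperatorTheory.deflatedFormBound_of_decomp`,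
hypothesis `hbeta`) is a ROUGH lower bound for the closed windowed Weil form on the part of the form domain
orthogonal to the trial vectors `v₁ … v_k`.  What a certificate (Yoshida's moment format augmented by `k`
rank-one forms, FEASIBILITY-234 v2 on 18085/18807) delivers is an inequality on SMOOTH sector tests,

  `(β)  β ∫|φ|² ≤ Re Q(φ) + Σ_i μ_i |∫ φ v̄_i|²`  for every smooth `φ` on `[-c, c]` with `φ(-x) = σ φ(x)`,

`μ_i ≥ 0`.  This file transfers it to the form domain: for every `h ∈ L²` vanishing off `[-c, c]`, of parity
`σ`, with finite archimedean energy and `∫ h v̄_i = 0` for all `i`,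

  `β ∫|h|² ≤ P(h) + 𝓔_c(h) − M_c ∫|h|²`                                   (`dt_beta_transfer`).

Mechanism (`dt_exists_sector_test_near`, the form-core technique of
`Theorems/GroundBartaPolarPerronFrobeniusFormDomainBottom`): compress `h` by an interior dilation (energies
converge, `tendsto_weilDirichletEnergy_weilDilate_window`; pole form and norm are `L²`-continuous), then mollify
inside the freed margin by an even bump (increments contract, parity `σ` is kept, `dt_exists_parity_mollified_seq`);
along the resulting smooth sector tests `φ → h` in `L²` with `P(φ) → P(h)`, `∫|φ|² → ∫|h|²`,
`limsup 𝓔_c(φ) ≤ 𝓔_c(h)` and `∫ φ v̄_i → ∫ h v̄_i = 0`, and `Re Q(φ) = P(φ) + 𝓔_c(φ) − M_c∫|φ|²` (Bombieri's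
Markov decomposition).  Prover B, speedrun unit `sr-gb-rung-b` (gen 3).

References: E. Bombieri, Rend. Mat. Acc. Lincei (9) 11 (2000) 183–233, Thm 2 and §4; M. Fukushima,
Y. Oshima, M. Takeda, *Dirichlet Forms and Symmetric Markov Processes* (2011) §1.1, Ex. 1.4.1 (`C_c^∞` is a
core of translation-invariant jump forms); A. Weinstein, W. Stenger, *Methods of Intermediate Problems for
Eigenvalues* (1972) Ch. 5 §9.
-/

set_option linter.dupNamespace false

noncomputable section

open MeasureTheory Set Filter ContinuousLinearMap
open scoped Topology ENNReal NNReal ComplexConjugate Convolution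

namespace Summit.RiemannHypothesis.RiemannHypothesis.Theorems.EvenWinsBeyondArch

open Literature.NumberTheory.LFunctions Literature.NumberTheory.LFunctions.ConnesVanSuijlekom
open Summit.RiemannHypothesis.RiemannHypothesis.Theorems.WeilGroundStateMarkovPart
  (weilIncrement_mollify_le integral_norm_sq_add_le)
open Summit.RiemannHypothesis.RiemannHypothesis.Theorems.OddSector
  (memLp_weilDilate weilDilate_eq_zero_of_notMem tendsto_weilPoleForm_of_window
    tendsto_integral_norm_sq_of_tendsto_sub)
open Summit.RiemannHypothesis.RiemannHypothesis.Theorems.PolarPerronFrobenius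
  (tendsto_weilDirichletEnergy_weilDilate_window tendsto_integral_norm_sq_weilDilate_sub_window
    weilDirichletEnergy_le_of_increment_le)

/-! ## Parity-preserving mollification and dilation -/

/-- **Mollification by an even kernel preserves parity**: for the normalised bump `K` centred at `0` and
`f(-x) = σ f(x)`, `(K ⋆ f)(-x) = σ (K ⋆ f)(x)`. -/
theorem dt_convolution_normed_parity (φ : ContDiffBump (0 : ℝ)) (σ : ℂ) {f : ℝ → ℂ}
    (hf : ∀ x, f (-x) = σ * f x) (x : ℝ) :
    (φ.normed volume ⋆[lsmul ℝ ℝ, volume] f) (-x) = σ * (φ.normed volume ⋆[lsmul ℝ ℝ, volume] f) x := by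
  simp only [convolution_lsmul]
  rw [← integral_const_mul, ← integral_neg_eq_self]
  refine integral_congr_ae (Eventually.of_forall fun t ↦ ?_)
  simp only [φ.normed_neg, show -x - -t = -(x - t) by ring, hf, Complex.real_smul]
  ring

/-- **Parity-`σ` mollified approximants of a window function.** For `f ∈ L²` vanishing off `[-b, b]` with
`f(-x) = σ f(x)`, the mollifications `gₙ = Kₙ ⋆ f` by normalised bumps of outer radius `1/(n+1)` are test
functions of the same parity supported in `[-(b + 1/(n+1)), b + 1/(n+1)]`, with `D_t(gₙ) ≤ D_t(f)` for every
`t`, converging to `f` in `L²`.  (Adapted from `WeilGroundStateMarkovPart.exists_mollified_seq`.) -/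
theorem dt_exists_parity_mollified_seq {b : ℝ} (σ : ℂ) {f : ℝ → ℂ} (hf : MemLp f 2)
    (hfs : ∀ x, x ∉ Icc (-b) b → f x = 0) (hfp : ∀ x, f (-x) = σ * f x) :
    ∃ g : ℕ → ℝ → ℂ,
      (∀ n, IsWeilTest (g n)) ∧ (∀ n x, g n (-x) = σ * g n x) ∧
      (∀ n, tsupport (g n) ⊆ Icc (-(b + 1 / ((n : ℝ) + 1))) (b + 1 / ((n : ℝ) + 1))) ∧
      (∀ n t, weilIncrement (g n) t ≤ weilIncrement f t) ∧
      Tendsto (fun n ↦ ∫ x, ‖g n x - f x‖ ^ 2) atTop (𝓝 0) := by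
  set φ : ℕ → ContDiffBump (0 : ℝ) := fun n ↦
    ⟨1 / ((n : ℝ) + 2), 1 / ((n : ℝ) + 1), by positivity,
      one_div_lt_one_div_of_lt (by positivity) (by linarith)⟩
  have hrOut : ∀ n, (φ n).rOut = 1 / ((n : ℝ) + 1) := fun n ↦ rfl
  have hfl : LocallyIntegrable f volume := hf.locallyIntegrable one_le_two
  have hfc : HasCompactSupport f := HasCompactSupport.intro isCompact_Icc hfs
  have hmem : ∀ n, MemLp ((φ n).normed volume ⋆[lsmul ℝ ℝ, volume] f) 2 volume := fun n ↦
    Literature.Analysis.UnboundedOperators.memLp_convolution_lsmul (φ n).integrable_normed hf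
      one_le_two
  refine ⟨fun n ↦ (φ n).normed volume ⋆[lsmul ℝ ℝ, volume] f, fun n ↦ ⟨?_, ?_⟩,
    fun n x ↦ dt_convolution_normed_parity (φ n) σ hfp x, fun n ↦ ?_,
    fun n t ↦ weilIncrement_mollify_le (φ n) hf t, ?_⟩
  · exact ((φ n).hasCompactSupport_normed (μ := volume)).contDiff_convolution_left _
      (φ n).contDiff_normed hfl
  · exact ((φ n).hasCompactSupport_normed (μ := volume)).convolution _ hfc
  · refine closure_minimal (fun x hx ↦ ?_) isClosed_Icc
    obtain ⟨y, hy, z, hz, rfl⟩ := support_convolution_subset (L := lsmul ℝ ℝ) (μ := volume)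
      (f := (φ n).normed volume) (g := f) hx
    rw [(φ n).support_normed_eq, hrOut, Metric.mem_ball, dist_zero_right, Real.norm_eq_abs,
      abs_lt] at hy
    have hz' : z ∈ Icc (-b) b := not_not.1 fun h ↦ hz (hfs z h)
    constructor <;> linarith [hz'.1, hz'.2, hy.1, hy.2]
  · have hT := Literature.Analysis.FunctionSpaces.tendsto_eLpNorm_normed_convolution_sub_self
      (μ := volume) (φ := φ) (l := atTop)
      (tendsto_one_div_add_atTop_nhds_zero_nat (𝕜 := ℝ)) one_le_two ENNReal.ofNat_ne_top hf
    have hT' : Tendsto (fun n ↦ Real.sqrt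
        (∫ x, ‖((φ n).normed volume ⋆[lsmul ℝ ℝ, volume] f) x - f x‖ ^ 2)) atTop (𝓝 0) := by
      have h2 := (ENNReal.tendsto_toReal ENNReal.zero_ne_top).comp hT
      rw [ENNReal.toReal_zero] at h2
      refine h2.congr fun n ↦ ?_
      rw [Function.comp_apply, eLpNorm_two_eq_ofReal_sqrt ((hmem n).sub hf),
        ENNReal.toReal_ofReal (Real.sqrt_nonneg _)]
      rfl
    have h3 := hT'.pow 2
    rw [zero_pow two_ne_zero] at h3
    refine h3.congr fun n ↦ ?_
    exact Real.sq_sqrt (integral_nonneg fun _ ↦ by positivity)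

/-- **Dilation preserves parity**: `(f_η)(-x) = σ f_η(x)` when `f(-x) = σ f(x)`. -/
theorem dt_weilDilate_parity (η : ℝ) (σ : ℂ) {f : ℝ → ℂ} (hf : ∀ x, f (-x) = σ * f x) (x : ℝ) :
    weilDilate η f (-x) = σ * weilDilate η f x := by
  simp only [weilDilate, mul_neg, hf]
  ring

/-! ## Smooth sector tests near a form-domain element -/

/-- **Smooth sector tests are dense in the sector form domain, with upper-semicontinuous energy.**  For
`c > 0` and `h ∈ L²` vanishing off `[-c, c]`, of parity `σ` (`h(-x) = σ h(x)`) and with finite archimedean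
energy, and every `δ > 0`, there is a smooth test `φ` of parity `σ` supported in `[-c, c]` with
`∫|φ − h|² < δ`, `|P(φ) − P(h)| < δ`, `|∫|φ|² − ∫|h|²| < δ` and `𝓔_c(φ) < 𝓔_c(h) + δ`
(interior dilation, then parity-preserving mollification inside the freed margin). -/
theorem dt_exists_sector_test_near {c : ℝ} (hc : 0 < c) (σ : ℂ) {h : ℝ → ℂ} (hh : MemLp h 2)
    (hhs : ∀ x, x ∉ Icc (-c) c → h x = 0) (hpar : ∀ x, h (-x) = σ * h x)
    (hE : IntegrableOn (fun t ↦ weilArchDensity t * weilIncrement h t) (Ioi 0)) {δ : ℝ} (hδ : 0 < δ) :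
    ∃ φ : ℝ → ℂ, IsWeilTest φ ∧ tsupport φ ⊆ Icc (-c) c ∧ (∀ x, φ (-x) = σ * φ x) ∧
      ∫ x, ‖φ x - h x‖ ^ 2 < δ ∧ |weilPoleForm φ - weilPoleForm h| < δ ∧
      |(∫ x, ‖φ x‖ ^ 2) - ∫ x, ‖h x‖ ^ 2| < δ ∧ weilDirichletEnergy c φ < weilDirichletEnergy c h + δ := by
  -- (1) interior dilates `f n = h_{η n}`, `η n = 1/(n+1)`
  set η : ℕ → ℝ := fun n ↦ 1 / ((n : ℝ) + 1) with hηdef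
  have hη0 : ∀ n, 0 ≤ η n := fun n ↦ by positivity
  have hηpos : ∀ n, 0 < η n := fun n ↦ by positivity
  have hη1 : ∀ n, η n ≤ 1 := fun n ↦ by
    rw [hηdef, div_le_one (by positivity)]; linarith [n.cast_nonneg (α := ℝ)]
  have hηm1 : ∀ n, -1 < η n := fun n ↦ by linarith [hη0 n]
  have hηlim : Tendsto η atTop (𝓝 0) := tendsto_one_div_add_atTop_nhds_zero_nat
  set f : ℕ → ℝ → ℂ := fun n ↦ weilDilate (η n) h with hfdef
  have hfm : ∀ n, MemLp (f n) 2 := fun n ↦ memLp_weilDilate hh (hηm1 n)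
  have hfs : ∀ n x, x ∉ Icc (-(c / (1 + η n))) (c / (1 + η n)) → f n x = 0 := fun n x hx ↦
    weilDilate_eq_zero_of_notMem (hηm1 n) hhs hx
  have hba : ∀ n, c / (1 + η n) < c := fun n ↦ by
    rw [div_lt_iff₀ (by linarith [hη0 n])]; nlinarith [hηpos n]
  have hfs' : ∀ n x, x ∉ Icc (-c) c → f n x = 0 := fun n x hx ↦
    hfs n x fun h ↦ hx ⟨by linarith [h.1, (hba n).le, neg_le_neg (hba n).le], h.2.trans (hba n).le⟩
  have hfpar : ∀ n x, f n (-x) = σ * f n x := fun n x ↦ dt_weilDilate_parity (η n) σ hpar x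
  obtain ⟨hfE, hElim⟩ := tendsto_weilDirichletEnergy_weilDilate_window c hc hh hhs hE hη0 hη1 hηlim
  have hfL : Tendsto (fun n ↦ ∫ x, ‖f n x - h x‖ ^ 2) atTop (𝓝 0) :=
    tendsto_integral_norm_sq_weilDilate_sub_window hh hhs hη0 hη1 hηlim
  have hPlim : Tendsto (fun n ↦ weilPoleForm (f n)) atTop (𝓝 (weilPoleForm h)) :=
    tendsto_weilPoleForm_of_window hh hfm hhs hfs' hfL
  have hNlim : Tendsto (fun n ↦ ∫ x, ‖f n x‖ ^ 2) atTop (𝓝 (∫ x, ‖h x‖ ^ 2)) :=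
    tendsto_integral_norm_sq_of_tendsto_sub hfm hh hfL
  have hδ4 : (0 : ℝ) < δ / 4 := by positivity
  have hδ2 : (0 : ℝ) < δ / 2 := by positivity
  have ev1 : ∀ᶠ n in atTop, ∫ x, ‖f n x - h x‖ ^ 2 < δ / 4 := hfL.eventually (eventually_lt_nhds hδ4)
  have ev2 : ∀ᶠ n in atTop, |weilPoleForm (f n) - weilPoleForm h| < δ / 2 := by
    have := (Metric.tendsto_nhds.1 hPlim) _ hδ2
    simpa only [Real.dist_eq] using this
  have ev3 : ∀ᶠ n in atTop, |(∫ x, ‖f n x‖ ^ 2) - ∫ x, ‖h x‖ ^ 2| < δ / 2 := by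
    have := (Metric.tendsto_nhds.1 hNlim) _ hδ2
    simpa only [Real.dist_eq] using this
  have ev4 : ∀ᶠ n in atTop, weilDirichletEnergy c (f n) < weilDirichletEnergy c h + δ :=
    hElim.eventually (eventually_lt_nhds (by linarith))
  obtain ⟨n, h1, h2, h3, h4⟩ := (ev1.and (ev2.and (ev3.and ev4))).exists
  -- (2) mollify `f n` inside the freed margin, keeping the parity
  obtain ⟨g, hgt, hgpar, hgs, hgD, hgL⟩ := dt_exists_parity_mollified_seq σ (hfm n) (hfs n) (hfpar n)
  have hgm : ∀ k, MemLp (g k) 2 := fun k ↦ (hgt k).memLp_two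
  have hmargin : 0 < c - c / (1 + η n) := by linarith [hba n]
  have evS : ∀ᶠ k in atTop, tsupport (g k) ⊆ Icc (-c) c := by
    have : ∀ᶠ k : ℕ in atTop, 1 / ((k : ℝ) + 1) < c - c / (1 + η n) :=
      tendsto_one_div_add_atTop_nhds_zero_nat.eventually (eventually_lt_nhds hmargin)
    filter_upwards [this] with k hk
    exact (hgs k).trans (Icc_subset_Icc (by linarith) (by linarith))
  have hgs1 : ∀ k x, x ∉ Icc (-(c + 1)) (c + 1) → g k x = 0 := fun k x hx ↦
    image_eq_zero_of_notMem_tsupport fun hm ↦ hx (by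
      have h' := hgs k hm
      have hk1 : 1 / ((k : ℝ) + 1) ≤ 1 := by
        rw [div_le_one (by positivity)]; linarith [k.cast_nonneg (α := ℝ)]
      exact ⟨by linarith [h'.1, (hba n).le], by linarith [h'.2, (hba n).le]⟩)
  have hfs1 : ∀ x, x ∉ Icc (-(c + 1)) (c + 1) → f n x = 0 := fun x hx ↦
    hfs' n x fun hm ↦ hx ⟨by linarith [hm.1], by linarith [hm.2]⟩
  have hgNlim : Tendsto (fun k ↦ ∫ x, ‖g k x‖ ^ 2) atTop (𝓝 (∫ x, ‖f n x‖ ^ 2)) :=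
    tendsto_integral_norm_sq_of_tendsto_sub hgm (hfm n) hgL
  have hgP : Tendsto (fun k ↦ weilPoleForm (g k)) atTop (𝓝 (weilPoleForm (f n))) :=
    tendsto_weilPoleForm_of_window (hfm n) hgm hfs1 hgs1 hgL
  have evg1 : ∀ᶠ k in atTop, ∫ x, ‖g k x - f n x‖ ^ 2 < δ / 4 := hgL.eventually (eventually_lt_nhds hδ4)
  have evg2 : ∀ᶠ k in atTop, |weilPoleForm (g k) - weilPoleForm (f n)| < δ / 2 := by
    have := (Metric.tendsto_nhds.1 hgP) _ hδ2
    simpa only [Real.dist_eq] using this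
  have evg3 : ∀ᶠ k in atTop, |(∫ x, ‖g k x‖ ^ 2) - ∫ x, ‖f n x‖ ^ 2| < δ / 2 := by
    have := (Metric.tendsto_nhds.1 hgNlim) _ hδ2
    simpa only [Real.dist_eq] using this
  obtain ⟨k, hkS, hk1, hk2, hk3⟩ := (evS.and (evg1.and (evg2.and evg3))).exists
  refine ⟨g k, hgt k, hkS, hgpar k, ?_, ?_, ?_, ?_⟩
  · -- `∫|g k − h|² ≤ 2∫|g k − f n|² + 2∫|f n − h|² < δ`
    have s1 := integral_norm_sq_add_le ((hgm k).sub (hfm n)) ((hfm n).sub hh)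
    have e1 : (fun x ↦ ‖(g k - f n) x + (f n - h) x‖ ^ 2) = fun x ↦ ‖g k x - h x‖ ^ 2 := by
      funext x; simp only [Pi.sub_apply, sub_add_sub_cancel]
    rw [e1] at s1
    simp only [Pi.sub_apply] at s1
    linarith
  · have := abs_sub_lt_iff.1 hk2
    have := abs_sub_lt_iff.1 h2
    rw [abs_sub_lt_iff]; constructor <;> linarith
  · have := abs_sub_lt_iff.1 hk3
    have := abs_sub_lt_iff.1 h3
    rw [abs_sub_lt_iff]; constructor <;> linarith
  · exact (weilDirichletEnergy_le_of_increment_le (hgD k)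
      (integrableOn_weilArchDensity_mul_weilIncrement (hgt k)) (hfE n)).trans_lt h4

/-! ## Continuity of the pairings `⟨·, v_i⟩` -/

/-- `‖∫ φ v̄ − ∫ h v̄‖ ≤ √∫|v|² · √∫|φ − h|²` (Cauchy–Schwarz in the first slot). -/
theorem dt_norm_pairing_sub_le {φ h v : ℝ → ℂ} (hφ : MemLp φ 2) (hh : MemLp h 2) (hv : MemLp v 2) :
    ‖(∫ x, φ x * conj (v x)) - ∫ x, h x * conj (v x)‖ ≤
      Real.sqrt (∫ x, ‖v x‖ ^ 2) * Real.sqrt (∫ x, ‖φ x - h x‖ ^ 2) := by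
  have e1 : ∫ x, φ x * conj (v x) = conj (∫ x, v x * conj (φ x)) := by
    rw [← integral_conj]; congr 1 with x; simp [mul_comm]
  have e2 : ∫ x, h x * conj (v x) = conj (∫ x, v x * conj (h x)) := by
    rw [← integral_conj]; congr 1 with x; simp [mul_comm]
  rw [e1, e2, ← map_sub, Complex.norm_conj]
  exact norm_integral_mul_conj_sub_le hv hφ hh

/-! ## The transfer -/

/-- **Transfer of a low-precision sector certificate to the form domain.**  Let `c > 0`, `σ ∈ ℂ` a parity
sign, `v₁ … v_k ∈ L²`, `μ_i ≥ 0`, and suppose the certificate inequality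
`β ∫|φ|² ≤ Re Q(φ) + Σ_i μ_i |∫ φ v̄_i|²` holds for every smooth test `φ` supported in `[-c, c]` with
`φ(-x) = σ φ(x)`.  Then every `h ∈ L²` vanishing off `[-c, c]`, with `h(-x) = σ h(x)`, finite archimedean energy
and `∫ h v̄_i = 0` for all `i`, satisfies `β ∫|h|² ≤ P(h) + 𝓔_c(h) − M_c ∫|h|²` — the closed form of the window
(Bombieri's Markov decomposition `Re Q = P + 𝓔_c − M_c‖·‖²` on tests, extended by density with
upper-semicontinuous energy). -/
theorem dt_beta_transfer {c : ℝ} (hc : 0 < c) (σ : ℂ) {k : ℕ} (v : Fin k → ℝ → ℂ)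
    (hv : ∀ i, MemLp (v i) 2) (μ : Fin k → ℝ) (hμ : ∀ i, 0 ≤ μ i) {β : ℝ}
    (hcert : ∀ φ : ℝ → ℂ, IsWeilTest φ → tsupport φ ⊆ Icc (-c) c → (∀ x, φ (-x) = σ * φ x) →
      β * ∫ x, ‖φ x‖ ^ 2 ≤ (weilQuadratic φ).re + ∑ i, μ i * ‖∫ x, φ x * conj (v i x)‖ ^ 2)
    {h : ℝ → ℂ} (hh : MemLp h 2) (hhs : ∀ x, x ∉ Icc (-c) c → h x = 0) (hpar : ∀ x, h (-x) = σ * h x)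
    (hE : IntegrableOn (fun t ↦ weilArchDensity t * weilIncrement h t) (Ioi 0))
    (horth : ∀ i, ∫ x, h x * conj (v i x) = 0) :
    β * ∫ x, ‖h x‖ ^ 2 ≤
      weilPoleForm h + weilDirichletEnergy c h - weilMarkovConstant c * ∫ x, ‖h x‖ ^ 2 := by
  set M : ℝ := weilMarkovConstant c with hM
  set Nv : Fin k → ℝ := fun i ↦ ∫ x, ‖v i x‖ ^ 2 with hNv
  have hNv0 : ∀ i, 0 ≤ Nv i := fun i ↦ integral_nonneg fun _ ↦ by positivity
  set K : ℝ := |β| + 2 + |M| + ∑ i, μ i * Nv i with hK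
  have hK0 : 0 ≤ K := by
    have : 0 ≤ ∑ i, μ i * Nv i := Finset.sum_nonneg fun i _ ↦ mul_nonneg (hμ i) (hNv0 i)
    rw [hK]; positivity
  refine le_of_forall_pos_lt_add fun ε hε ↦ ?_
  -- choose `δ` with `δ K < ε`
  set δ : ℝ := ε / (K + 1) with hδ
  have hδ0 : 0 < δ := by positivity
  have hδK : δ * K < ε := by
    rw [hδ, div_mul_eq_mul_div, div_lt_iff₀ (by positivity)]; nlinarith
  obtain ⟨φ, hφt, hφs, hφpar, hL, hP, hN, hD⟩ := dt_exists_sector_test_near hc σ hh hhs hpar hE hδ0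
  have hφm : MemLp φ 2 := hφt.memLp_two
  have hc1 := hcert φ hφt hφs hφpar
  rw [weilQuadratic_re_eq_weilPoleForm_add_weilDirichletEnergy_sub hφt hφs, ← hM] at hc1
  -- the pairings are small: `|∫ φ v̄_i|² ≤ δ ∫|v_i|²`
  have hpair : ∀ i, ‖∫ x, φ x * conj (v i x)‖ ^ 2 ≤ δ * Nv i := by
    intro i
    have h1 := dt_norm_pairing_sub_le hφm hh (hv i)
    rw [horth i, sub_zero] at h1
    have h2 : ‖∫ x, φ x * conj (v i x)‖ ^ 2 ≤
        (Real.sqrt (Nv i) * Real.sqrt (∫ x, ‖φ x - h x‖ ^ 2)) ^ 2 :=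
      pow_le_pow_left₀ (norm_nonneg _) h1 2
    rw [mul_pow, Real.sq_sqrt (hNv0 i), Real.sq_sqrt (integral_nonneg fun _ ↦ by positivity)] at h2
    calc ‖∫ x, φ x * conj (v i x)‖ ^ 2 ≤ Nv i * ∫ x, ‖φ x - h x‖ ^ 2 := h2
      _ ≤ Nv i * δ := mul_le_mul_of_nonneg_left hL.le (hNv0 i)
      _ = δ * Nv i := mul_comm _ _
  have hsum : ∑ i, μ i * ‖∫ x, φ x * conj (v i x)‖ ^ 2 ≤ δ * ∑ i, μ i * Nv i := by
    rw [Finset.mul_sum]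
    refine Finset.sum_le_sum fun i _ ↦ ?_
    calc μ i * ‖∫ x, φ x * conj (v i x)‖ ^ 2 ≤ μ i * (δ * Nv i) :=
          mul_le_mul_of_nonneg_left (hpair i) (hμ i)
      _ = δ * (μ i * Nv i) := by ring
  -- bookkeeping
  have hP' := abs_sub_lt_iff.1 hP
  have hN' := abs_sub_lt_iff.1 hN
  have hβ1 : β * (∫ x, ‖h x‖ ^ 2) ≤ β * (∫ x, ‖φ x‖ ^ 2) + |β| * δ := by
    have h0 : |β * ((∫ x, ‖h x‖ ^ 2) - ∫ x, ‖φ x‖ ^ 2)| ≤ |β| * δ := by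
      rw [abs_mul]
      exact mul_le_mul_of_nonneg_left (by rw [abs_sub_comm]; exact hN.le) (abs_nonneg _)
    have h1 := (abs_le.1 h0).2
    rw [mul_sub] at h1
    linarith
  have hM1 : -(M * ∫ x, ‖φ x‖ ^ 2) ≤ -(M * ∫ x, ‖h x‖ ^ 2) + |M| * δ := by
    have h0 : |M * ((∫ x, ‖φ x‖ ^ 2) - ∫ x, ‖h x‖ ^ 2)| ≤ |M| * δ := by
      rw [abs_mul]
      exact mul_le_mul_of_nonneg_left hN.le (abs_nonneg _)
    have h1 := (abs_le.1 h0).1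
    rw [mul_sub] at h1
    linarith
  have hKe : δ * K = |β| * δ + δ + δ + |M| * δ + δ * ∑ i, μ i * Nv i := by rw [hK]; ring
  have htot : β * (∫ x, ‖h x‖ ^ 2) ≤
      weilPoleForm h + weilDirichletEnergy c h - M * (∫ x, ‖h x‖ ^ 2) + δ * K := by
    rw [hKe]
    linarith [hc1, hsum, hβ1, hM1, hP'.1, hD]
  calc β * (∫ x, ‖h x‖ ^ 2)
      ≤ weilPoleForm h + weilDirichletEnergy c h - M * (∫ x, ‖h x‖ ^ 2) + δ * K := htot
    _ < weilPoleForm h + weilDirichletEnergy c h - M * (∫ x, ‖h x‖ ^ 2) + ε := by linarith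

end Summit.RiemannHypothesis.RiemannHypothesis.Theorems.EvenWinsBeyondArch

end
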